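import Summits.BirchSwinnertonDyer.Rank1Residual.Additive.RamifiedOrdinaryLineHalfPowerCore
import Summits.BirchSwinnertonDyer.Rank1Residual.Additive.RamifiedOrdinaryLineMatchingLineExponent
import HarnessLib

/-!
# The HALF-POWER of inertia on the ramified ordinary line: `σ^{(p−1)/2}` is trivial on `C[p]` for
# every (G-ord) row with EVEN defect `e ≠ 2` and ODD `(p−1)/e` — the (P-e46-odd) producer, and the
# line matching on the equal-parity swap-locus links `(5; 4,4)`, `(7; 6,6)` it unlocks
# (cell `b2b-bsdres`, team n1011, seat p16 (gen 7); row T-QEXP FILE Q4; the `hℓ` supply at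
# `ℓ = (p−1)/2` for cc-typer-2's S4 `RamifiedOrdinaryLineMatchingLineExponent.inclusion_mem_iff_of_lineHalfPow`)

HONEST FRAMING (cell `b2b-bsdres`, run/shared/lean/b2b/bsd-rank1-residual/, verbatim in every
file): the goal of the cell is to DELETE the COMBINATION-SHAPED residual classes of the
Birch–Swinnerton-Dyer formula for ALL analytic-rank `≤ 1` elliptic curves over `ℚ` — "full BSD
formula for every rank `≤ 1` curve in class `C`" assembled STRICTLY from published theorems — so
that the rank-`≤ 1` remainder becomes exactly the CONSTRUCTION-SHAPED classes, which are TYPED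
(missing-input `Prop`s), NOT attempted. This is not "finishing BSD". Team n1011 (N10/N11): research
route on the CONSTRUCTION-SHAPED classes X3♯(G-ord)/X4♯(G-ord); prove what is provable now; no
claim beyond stated classes; census output = EVIDENCE, never a Literature fact; RESIDUAL-MAP marks
UNCHANGED; nothing is booked by this file. TOOL theorems only: NO definition, NO named fact, NO
conjecture node; hypotheses = `TypeGOrd`, `Addv`, `5 ≤ p`, the parity of `e`, `p ∈ v`, the line.

## What and why

cc-typer-2's S4 matches the ramified ordinary lines `C ⊂ E[p^∞]`, `C₁ ⊂ E₁[p^∞]` of an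
equal-parity congruence link ON the swap locus `(p−1) ∣ lcm(e, e₁)` from the LINE half-powers
`hℓ : ∀ σ ∈ I_v, ∀ m ∈ C, p·m = 0 → σ^{(p−1)/2} m = m` on both members; its live customers (the
(5;4,4) and (7;6,6) CONG links of class-closure N10) were "all modulo ONE producer (P-e46-odd): the
EXACT order `e` of the quotient character, not in the tree" (`N10/TRANSPORT-TEMPLATE.md` v2.1).
FILE Q3 (`RamifiedOrdinaryLineHalfPowerCore`) proved the model-free core (a SIGN `(χ̄_p/p)` on the
quotient at exponent `n` with `nk = (p−1)/2`, `k` odd, gives `hℓ`) and that the line of the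
Kummer–Deuring model HAS the sign at `n = e/2` (Gauss sum; reduced automorphism `[±1]`). Here:

* §C **`GoodModelLine.exists_isRamifiedOrdinaryLine_and_lineHalfPow[_of_typeGOrd]`** — the model
  line is a ramified ordinary line (p07 B §2's assembly verbatim: ordinary point by F-B from
  `j̃ ∈ {0, 1728}`, F-A3 `isRamifiedOrdinaryLine_of_goodModel`) with `hℓ` (Q3 §B + §A at `n = e/2`,
  `k = (p−1)/e`); END **`IsRamifiedOrdinaryLine.lineHalfPow_of_typeGOrd_of_even`** (`p ≥ 5`,
  `TypeGOrd`, `Addv`, `2 ∣ e`, `e ≠ 2`, `¬ 2 ∣ (p−1)/e`, `v ∋ p`, ANY ramified ordinary line — by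
  cc-typer-2's uniqueness) = S4's `hℓ` binder-for-binder; class forms
  `ClassX4Gord./ClassX3Gord.lineHalfPow_of_even_of_ne_two`;
* §D the CUSTOMER shape: two (G-ord) curves with even defects `≠ 2` and odd `(p−1)/e`, `(p−1)/e₁`
  (cells `(5; 4,4)`, `(7; 6,6)`) have MATCHING ramified ordinary lines under every inertia-equivariant
  `E[p] ≃+ E₁[p]` (S4 fed by the END): `exists_lines_matching_of_typeGOrd_of_even` + class pair forms.

HONEST LIMIT: `e = 2` rows are cc-typer-2's (P-def2-odd), NOT claimed (`he2`); the cube part of the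
exact order is not proved; nothing on MIXED-parity links (S4b); matching is a TOOL step of the
Route-G / R3″ transports, not an END — nothing booked.
References: Serre–Tate, Ann. of Math. 88 (1968) §2 [SerreTate1968]; Serre, Invent. Math. 15 (1972)
§5.6 [Serre1972]; Greenberg–Vatsal, Invent. Math. 142 (2000) §2 p. 26, Rem. (2.9) [GreenbergVatsal2000];
Emerton–Pollack–Weston, Invent. Math. 163 (2006) §3.1 [EmertonPollackWeston2006]; Silverman *AEC*
III.8.1, VII.2.1, VII.5.5 [SilvermanAEC2009]; cells/n1011/skel/T-QEXP.md; N10/TRANSPORT-TEMPLATE.md v2.1.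
-/

set_option autoImplicit false

noncomputable section

open scoped Classical NNReal NumberField AddSubgroup

open WeierstrassCurve

universe u

namespace Summit.BirchSwinnertonDyer.Rank1Residual.Additive.GoodModelLine

open NumberField IsDedekindDomain Field IsDedekindDomain.HeightOneSpectrum
  Literature.NumberTheory.GaloisRepresentations Literature.NumberTheory.EllipticCurves
  Literature.NumberTheory.EllipticCurves.GreenbergSelmer
  Literature.NumberTheory.EllipticCurves.EmertonPollackWeston2006
  Literature.NumberTheory.EllipticCurves.Rank1Residual
  Literature.NumberTheory.EllipticCurves.Rank1Residual.Typed
  Summit.BirchSwinnertonDyer.Rank1Residual.X2.GreenbergVatsalReductionDatum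

/-! ## §C The END on (G-ord) rows with even defect `e ≠ 2` and odd `(p−1)/e` -/

section Gord

variable (W : WeierstrassCurve ℚ) [W.IsElliptic] [W.IsGloballyMinimal] (p : ℕ) [hp : Fact p.Prime]
  {v : HeightOneSpectrum (𝓞 ℚ)}

set_option maxHeartbeats 400000 in -- `hred` by `rfl` through three transports (as in F-A3 / p07 B §2)
/-- **The model line has the half-power property.** `E/ℚ` globally minimal, `p ≥ 5`, `v ∋ p`,
`ord_p j ≥ 0`, `e = semistabilityIndex W p` even with `e ∣ p − 1`, `e ≠ 1, 2`, `(p−1)/e` odd, `E` bad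
at `v`: SOME ramified ordinary line `Lv` of `E` at `v` satisfies
`∀ σ ∈ I_v, ∀ m ∈ Lv.plus, p·m = 0 → σ^{(p−1)/2} m = m` — the line of Q1's explicit model (p07 B §2's
assembly: ordinary point by F-B from `j̃ ∈ {0, 1728}`, F-A3 `isRamifiedOrdinaryLine_of_goodModel`),
§B for the sign at `n = e/2`, §A with `k = (p−1)/e`. [cite: SerreTate1968, §2 Thm. 2 and Cor. 2]
[cite: SilvermanAEC2009, Prop. VII.5.5, Thm. V.4.1(a)] [cite: GreenbergVatsal2000, §2 p. 26] -/
theorem exists_isRamifiedOrdinaryLine_and_lineHalfPow (hp5 : 5 ≤ p)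
    (hpv : ((p : ℕ) : 𝓞 ℚ) ∈ v.asIdeal) (hj : 0 ≤ padicValRat p W.j)
    (hedvd : semistabilityIndex W p ∣ p - 1) (he1 : semistabilityIndex W p ≠ 1)
    (he2 : semistabilityIndex W p ≠ 2) (h2e : 2 ∣ semistabilityIndex W p)
    (hodd : ¬ 2 ∣ (p - 1) / semistabilityIndex W p) (hbad : ¬ W.HasGoodReductionAt v) :
    ∃ Lv : LocalDatum ℚ (W.geomPrimaryTorsion p) v, IsRamifiedOrdinaryLine W p Lv ∧
      ∀ σ ∈ absInertia (v.adicCompletion ℚ), ∀ m ∈ Lv.plus, p • m = 0 →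
        (absGaloisRestrict ℚ (v.adicCompletion ℚ) σ) ^ ((p - 1) / 2) • m = m := by
  haveI : NeZero ((p : ℕ) : v.adicCompletion ℚ) := ⟨by
    rw [← map_natCast (algebraMap ℚ (v.adicCompletion ℚ))]
    exact (map_ne_zero_iff _ (algebraMap ℚ (v.adicCompletion ℚ)).injective).mpr
      (Nat.cast_ne_zero.mpr hp.out.ne_zero)⟩
  have hp2 : p ≠ 2 := by omega
  have he12 := semistabilityIndex_dvd_twelve W p
  have hecase : semistabilityIndex W p = 3 ∨ semistabilityIndex W p = 4 ∨ semistabilityIndex W p = 6 ∨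
      semistabilityIndex W p = 12 := by
    have hle : semistabilityIndex W p ≤ 12 := Nat.le_of_dvd (by norm_num) he12
    interval_cases h : semistabilityIndex W p <;> omega
  have he0 : semistabilityIndex W p ≠ 0 := semistabilityIndex_ne_zero p W
  have hpe : ¬ p ∣ semistabilityIndex W p := not_dvd_semistabilityIndex p W hp5
  have hmodd := odd_div_gcd_of_two_dvd_semistabilityIndex p W h2e
  -- the EXPLICIT good model with its Kummer element
  obtain ⟨u, C, W₀, -, hu, hW₀, hΔ, ha₁, -, ha₃, hCmap⟩ := exists_kummerGoodModel_explicit p W hp5 hpv hj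
  haveI := charP_residueField_specVal p hpv
  -- the ordinary point (verbatim from p07 B §2 / F-C2)
  have hord : ∃ P : (W₀.baseChange (AlgebraicClosure (v.adicCompletion ℚ))).toAffine.Point,
      (p : ℤ) • P = 0 ∧ goodReductionHom W₀ (Valuation.integer.integers (specVal v)) hΔ P ≠ 0 := by
    by_cases h3e : 3 ∣ semistabilityIndex W p
    · have h3v : ¬ 3 ∣ padicValInt p W.minimalDiscriminantInt := by
        intro h
        have : 3 ∣ 4 := dvd_trans h3e (semistabilityIndex_dvd_four_of_three_dvd W p h)
        omega
      exact exists_torsion_goodReductionHom_ne_zero_of_residue_c₄_eq_zero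
        (O := (specVal v).valuationSubring) (Valuation.integer.integers (specVal v)) hΔ p hp5
        (dvd_trans h3e hedvd)
        (residue_c₄_eq_zero_of_goodModel W p hpv hW₀ hΔ
          (j_eq_zero_or_padicValRat_j_pos_of_not_three_dvd W p hj h3v))
    · have h4e : 4 ∣ semistabilityIndex W p := by
        rcases hecase with h | h | h | h <;> rw [h] at h3e ⊢ <;> omega
      have h2v : ¬ 2 ∣ padicValInt p W.minimalDiscriminantInt := by
        intro h
        have : 4 ∣ 6 := dvd_trans h4e (semistabilityIndex_dvd_six_of_two_dvd W p h)
        omega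
      exact exists_torsion_goodReductionHom_ne_zero_of_residue_c₆_eq_zero
        (O := (specVal v).valuationSubring) (Valuation.integer.integers (specVal v)) hΔ p hp5
        (dvd_trans h4e hedvd)
        (residue_c₆_eq_zero_of_goodModel W p hpv hW₀ hΔ
          (j_eq_or_padicValRat_j_sub_pos_of_not_two_dvd W p hp5 hj h2v))
  -- the datum with its reduction map (as in F-A3 / p07 B §2)
  let Φ₁ : localPoints W (v.adicCompletion ℚ) ≃+
      ((W.baseChange (v.adicCompletion ℚ)).baseChange (AlgebraicClosure (v.adicCompletion ℚ))).toAffine.Point :=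
    Affine.Point.congrEquiv (baseChange_baseChange_adicCompletion W v).symm
  let Φ : localPoints W (v.adicCompletion ℚ) ≃+
      (W₀.baseChange (AlgebraicClosure (v.adicCompletion ℚ))).toAffine.Point :=
    (Φ₁.trans (VariableChange.pointEquiv _ C)).trans (Affine.Point.congrEquiv hW₀)
  let red : localPoints W (v.adicCompletion ℚ) →+
      (W₀.map (IsLocalRing.residue (specVal v).integer)).toAffine.Point :=
    (goodReductionHom W₀ (Valuation.integer.integers (specVal v)) hΔ).comp Φ.toAddMonoidHom
  have hred : ∀ P, red P = goodReductionHom W₀ (Valuation.integer.integers (specVal v)) hΔ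
      (Affine.Point.congrEquiv hW₀ (VariableChange.pointEquiv _ C
        (Affine.Point.congrEquiv (baseChange_baseChange_adicCompletion W v).symm P))) := fun _ ↦ rfl
  obtain ⟨Lv, hLv⟩ := exists_localDatum_mem_iff_red_eq_zero W p hW₀ hΔ red hred
  have hLvline : IsRamifiedOrdinaryLine W p Lv :=
    isRamifiedOrdinaryLine_of_goodModel W p hW₀ hΔ red hred hord Lv hLv hpv hbad
  refine ⟨Lv, hLvline, ?_⟩
  -- the sign at `n = e/2`, then the model-free core with `k = (p−1)/e`
  have hsign := pow_smul_sub_sign_smul_mem_plus W p hW₀ hΔ red hred Lv hLv hp2 hpv ha₁ ha₃ he0 h2e hpe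
    hmodd hu hCmap
  have hk : Odd ((p - 1) / semistabilityIndex W p) := by
    rw [Nat.odd_iff]; omega
  have hnk : semistabilityIndex W p / 2 * ((p - 1) / semistabilityIndex W p) = (p - 1) / 2 := by
    obtain ⟨e', he'⟩ := h2e
    obtain ⟨q, hq⟩ := hedvd
    have he'0 : 0 < e' := by
      rcases Nat.eq_zero_or_pos e' with h | h
      · rw [h, mul_zero] at he'; exact absurd he' he0
      · exact h
    rw [hq, he']
    have h1 : 2 * e' / 2 = e' := Nat.mul_div_cancel_left e' two_pos
    have h2 : 2 * e' * q / (2 * e') = q := Nat.mul_div_cancel_left q (by omega)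
    have h3 : 2 * e' * q / 2 = e' * q := by
      rw [mul_assoc]; exact Nat.mul_div_cancel_left _ two_pos
    rw [h1, h2, h3]
  exact hLvline.lineHalfPow_of_quotSign hp2 hk hnk hsign

/-- **On a (G-ord) row** (`p ≥ 5`, `e` even, `e ≠ 2`, `(p−1)/e` odd): SOME ramified ordinary line with
the half-power property — the binders of the generic form discharged from `TypeGOrd W p ∧ Addv W p`
(`ord_p j ≥ 0`, `e ∣ p − 1`, `e ≠ 1`, bad at `v`: additive-p2 `typeG_iff_not_subM_and_semistabilityIndex_dvd`,
`semistabilityIndex_ne_one_of_addv`, `hasAdditiveReductionAt_of_addv`).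
[cite: SerreTate1968, §2 Thm. 2 and Cor. 2] [cite: GreenbergVatsal2000, §2 p. 26] -/
theorem exists_isRamifiedOrdinaryLine_and_lineHalfPow_of_typeGOrd (hp5 : 5 ≤ p)
    (hG : TypeGOrd W p) (hadd : Addv W p) (h2e : 2 ∣ semistabilityIndex W p)
    (he2 : semistabilityIndex W p ≠ 2) (hodd : ¬ 2 ∣ (p - 1) / semistabilityIndex W p)
    (hpv : ((p : ℕ) : 𝓞 ℚ) ∈ v.asIdeal) :
    ∃ Lv : LocalDatum ℚ (W.geomPrimaryTorsion p) v, IsRamifiedOrdinaryLine W p Lv ∧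
      ∀ σ ∈ absInertia (v.adicCompletion ℚ), ∀ m ∈ Lv.plus, p • m = 0 →
        (absGaloisRestrict ℚ (v.adicCompletion ℚ) σ) ^ ((p - 1) / 2) • m = m := by
  have hj : 0 ≤ padicValRat p W.j := padicValRat_j_nonneg_of_typeGOrd W p hG
  have hedvd : semistabilityIndex W p ∣ p - 1 :=
    ((typeG_iff_not_subM_and_semistabilityIndex_dvd W p hp5).mp hG.typeG).2
  have he1 := semistabilityIndex_ne_one_of_addv W p hp5 hadd hj
  have hbad : ¬ W.HasGoodReductionAt v := by
    rw [eq_primesEquiv_symm p hpv]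
    exact (hasAdditiveReductionAt_of_addv W p hadd).not_hasGoodReductionAt
  exact exists_isRamifiedOrdinaryLine_and_lineHalfPow W p hp5 hpv hj hedvd he1 he2 h2e hodd hbad

end Gord

end Summit.BirchSwinnertonDyer.Rank1Residual.Additive.GoodModelLine

/-! ## §C (continued) EVERY ramified ordinary line (uniqueness), and the class forms -/

namespace Literature.NumberTheory.EllipticCurves.EmertonPollackWeston2006.IsRamifiedOrdinaryLine

open NumberField IsDedekindDomain Field IsDedekindDomain.HeightOneSpectrum WeierstrassCurve
  Literature.NumberTheory.GaloisRepresentations Literature.NumberTheory.EllipticCurves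
  Literature.NumberTheory.EllipticCurves.GreenbergSelmer
  Literature.NumberTheory.EllipticCurves.Rank1Residual
  Summit.BirchSwinnertonDyer.Rank1Residual.Additive
  Summit.BirchSwinnertonDyer.Rank1Residual.Additive.GoodModelLine

variable {W : WeierstrassCurve ℚ} [W.IsElliptic] [W.IsGloballyMinimal] {p : ℕ} [hp : Fact p.Prime]
  {v : HeightOneSpectrum (𝓞 ℚ)}

/-- **THE HALF-POWER OF INERTIA IS TRIVIAL ON THE RAMIFIED ORDINARY LINE — the (P-e46-odd)
producer.** For `E/ℚ` globally minimal, `p ≥ 5`, additive at `p` of type (G)-ordinary with EVEN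
semistability defect `e = semistabilityIndex W p ≠ 2` (so `e ∈ {4, 6}`) and `(p−1)/e` ODD (`e = 4` at
`p ≡ 5 (8)`, `e = 6` at `p ≡ 7 (12)`), and ANY ramified ordinary line `L` of `E` at `v ∋ p`: every
local inertia element `σ` satisfies `σ^{(p−1)/2} m = m` for all `m ∈ C = L.plus` killed by `p` —
the LINE character `ψ₁ = χ̄_p ψ₂⁻¹` is an EVEN power of a generator of the tame characters, because
the quadratic part of the quotient character is `ψ₂^{e/2} = (χ̄_p/p)` (Q2, Gauss sum on the
Kummer–Deuring model) and `(χ̄_p/p)^{1 + (p−1)/e} = 1`. This is the `hℓ` binder of cc-typer-2's S4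
`inclusion_mem_iff_of_lineHalfPow` / `exists_lines_matching_of_lineHalfPow` at `ℓ = (p−1)/2`. By
cc-typer-2's model-free uniqueness the given line IS the explicit-model line of
`exists_isRamifiedOrdinaryLine_and_lineHalfPow_of_typeGOrd`. NOT claimed: `e = 2` (cc-typer-2's
(P-def2-odd)); the exact order of `ψ₂`. [cite: SerreTate1968, §2 Thm. 2 and Cor. 2]
[cite: Serre1972, §5.6 (p. 312)] [cite: GreenbergVatsal2000, §2 p. 26]
[cite: EmertonPollackWeston2006, §3.1 (eq:ordes) (arXiv:math/0404484 p. 17)] -/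
theorem lineHalfPow_of_typeGOrd_of_even (hp5 : 5 ≤ p) (hG : TypeGOrd W p) (hadd : Addv W p)
    (h2e : 2 ∣ semistabilityIndex W p) (he2 : semistabilityIndex W p ≠ 2)
    (hodd : ¬ 2 ∣ (p - 1) / semistabilityIndex W p) (hpv : ((p : ℕ) : 𝓞 ℚ) ∈ v.asIdeal)
    {L : LocalDatum ℚ (W.geomPrimaryTorsion p) v} (hL : IsRamifiedOrdinaryLine W p L) :
    ∀ σ ∈ absInertia (v.adicCompletion ℚ), ∀ m ∈ L.plus, p • m = 0 →
      (absGaloisRestrict ℚ (v.adicCompletion ℚ) σ) ^ ((p - 1) / 2) • m = m := by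
  obtain ⟨L', hL', hpow⟩ :=
    exists_isRamifiedOrdinaryLine_and_lineHalfPow_of_typeGOrd W p hp5 hG hadd h2e he2 hodd hpv
  rw [hL.eq_of_isRamifiedOrdinaryLine hL' hpv]
  exact hpow

/-- **TT v2.1's typed (P-e46-odd) statement, VERBATIM binder shape** (`class-closure/N10/TRANSPORT-TEMPLATE.md`
v2.1 §PRODUCERS: `(he : semistabilityIndex W p = e) (he46 : e = 4 ∨ e = 6) (hodd : ¬ 2 ∣ (p−1)/e)`): the
`e ∈ {4, 6}` instances of `lineHalfPow_of_typeGOrd_of_even`. [cite: SerreTate1968, §2 Thm. 2 and Cor. 2]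
[cite: GreenbergVatsal2000, §2 p. 26] -/
theorem lineHalfPow_of_typeGOrd_of_semistabilityIndex (hp5 : 5 ≤ p) (hG : TypeGOrd W p)
    (hadd : Addv W p) {e : ℕ} (he : semistabilityIndex W p = e) (he46 : e = 4 ∨ e = 6)
    (hodd : ¬ 2 ∣ (p - 1) / e) (hpv : ((p : ℕ) : 𝓞 ℚ) ∈ v.asIdeal)
    {L : LocalDatum ℚ (W.geomPrimaryTorsion p) v} (hL : IsRamifiedOrdinaryLine W p L) :
    ∀ σ ∈ absInertia (v.adicCompletion ℚ), ∀ m ∈ L.plus, p • m = 0 →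
      (absGaloisRestrict ℚ (v.adicCompletion ℚ) σ) ^ ((p - 1) / 2) • m = m := by
  subst he
  have h2e : 2 ∣ semistabilityIndex W p := by
    rcases he46 with h | h <;> rw [h] <;> norm_num
  have he2 : semistabilityIndex W p ≠ 2 := by
    rcases he46 with h | h <;> rw [h] <;> norm_num
  exact hL.lineHalfPow_of_typeGOrd_of_even hp5 hG hadd h2e he2 hodd hpv

end Literature.NumberTheory.EllipticCurves.EmertonPollackWeston2006.IsRamifiedOrdinaryLine

namespace Summit.BirchSwinnertonDyer.Rank1Residual.Additive

open NumberField IsDedekindDomain Field IsDedekindDomain.HeightOneSpectrum WeierstrassCurve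
  Literature.NumberTheory.GaloisRepresentations Literature.NumberTheory.EllipticCurves
  Literature.NumberTheory.EllipticCurves.GreenbergSelmer
  Literature.NumberTheory.EllipticCurves.EmertonPollackWeston2006
  Literature.NumberTheory.EllipticCurves.Rank1Residual

variable {W : WeierstrassCurve ℚ} [W.IsElliptic] [W.IsGloballyMinimal] {p : ℕ} [hp : Fact p.Prime]
  {v : HeightOneSpectrum (𝓞 ℚ)}

/-- **X4♯(G-ord), `p ≥ 5`, even defect `e ≠ 2`, odd `(p−1)/e`: every ramified ordinary line has the
half-power property** (S4's `hℓ` at `(p−1)/2`). X4♯(G-ord) stays CONSTRUCTION-SHAPED; nothing booked.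
[cite: SerreTate1968, §2 Thm. 2 and Cor. 2] [cite: GreenbergVatsal2000, §2 p. 26] -/
theorem ClassX4Gord.lineHalfPow_of_even_of_ne_two (hX : ClassX4Gord W p) (hp5 : 5 ≤ p)
    (h2e : 2 ∣ semistabilityIndex W p) (he2 : semistabilityIndex W p ≠ 2)
    (hodd : ¬ 2 ∣ (p - 1) / semistabilityIndex W p) (hpv : ((p : ℕ) : 𝓞 ℚ) ∈ v.asIdeal)
    {L : LocalDatum ℚ (W.geomPrimaryTorsion p) v} (hL : IsRamifiedOrdinaryLine W p L) :
    ∀ σ ∈ absInertia (v.adicCompletion ℚ), ∀ m ∈ L.plus, p • m = 0 →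
      (absGaloisRestrict ℚ (v.adicCompletion ℚ) σ) ^ ((p - 1) / 2) • m = m :=
  hL.lineHalfPow_of_typeGOrd_of_even hp5 hX.typeGOrd hX.addv.2 h2e he2 hodd hpv

/-- **X3♯(G-ord), `p ≥ 5`, even defect `e ≠ 2`, odd `(p−1)/e`: every ramified ordinary line has the
half-power property** (S4's `hℓ` at `(p−1)/2`). X3♯(G-ord) stays CONSTRUCTION-SHAPED; nothing booked.
[cite: SerreTate1968, §2 Thm. 2 and Cor. 2] [cite: GreenbergVatsal2000, §2 p. 26] -/
theorem ClassX3Gord.lineHalfPow_of_even_of_ne_two (hX : ClassX3Gord W p) (hp5 : 5 ≤ p)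
    (h2e : 2 ∣ semistabilityIndex W p) (he2 : semistabilityIndex W p ≠ 2)
    (hodd : ¬ 2 ∣ (p - 1) / semistabilityIndex W p) (hpv : ((p : ℕ) : 𝓞 ℚ) ∈ v.asIdeal)
    {L : LocalDatum ℚ (W.geomPrimaryTorsion p) v} (hL : IsRamifiedOrdinaryLine W p L) :
    ∀ σ ∈ absInertia (v.adicCompletion ℚ), ∀ m ∈ L.plus, p • m = 0 →
      (absGaloisRestrict ℚ (v.adicCompletion ℚ) σ) ^ ((p - 1) / 2) • m = m :=
  hL.lineHalfPow_of_typeGOrd_of_even hp5 hX.typeGOrd hX.addv h2e he2 hodd hpv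

end Summit.BirchSwinnertonDyer.Rank1Residual.Additive

/-! ## §D The customer shape: matching lines on the equal-parity cells `(5; 4,4)`, `(7; 6,6)` -/

namespace Summit.BirchSwinnertonDyer.Rank1Residual.Additive

open NumberField IsDedekindDomain Field IsDedekindDomain.HeightOneSpectrum WeierstrassCurve
  Literature.NumberTheory.GaloisRepresentations Literature.NumberTheory.EllipticCurves
  Literature.NumberTheory.EllipticCurves.GreenbergSelmer
  Literature.NumberTheory.EllipticCurves.EmertonPollackWeston2006
  Literature.NumberTheory.EllipticCurves.Rank1Residual
  Summit.BirchSwinnertonDyer.Rank1Residual.Additive.GoodModelLine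
open WeierstrassCurve (geomTorsion geomPrimaryTorsion geomTorsion_le_geomPrimaryTorsion)

variable {W W₁ : WeierstrassCurve ℚ} [W.IsElliptic] [W.IsGloballyMinimal] [W₁.IsElliptic]
  [W₁.IsGloballyMinimal] {p : ℕ} [hp : Fact p.Prime] {v : HeightOneSpectrum (𝓞 ℚ)}

/-- **Two (G-ord) curves with even defects `≠ 2` and odd `(p−1)/e`, `(p−1)/e₁` have MATCHING
ramified ordinary lines under EVERY `Γ_ℚ`-equivariant `E[p] ≃+ E₁[p]`** (`p ≥ 5`; the cells
`(5; 4,4)` and `(7; 6,6)` of cc-typer-2's parity dictionary, ON the swap locus `(p−1) ∣ lcm(e, e₁)`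
where S3's exponent road is void): S4 `exists_lines_matching_of_lineHalfPow` fed by the END
`lineHalfPow_of_typeGOrd_of_even` on both members. A TOOL step (the `hlines`/`TorsionIso` line clause
of the Route-G transports), not an END. [cite: GreenbergVatsal2000, §2 p. 26 and Remark (2.9)]
[cite: EmertonPollackWeston2006, pp. 2–3 and §3.1 (eq:ordes) (arXiv:math/0404484 p. 17)] -/
theorem exists_lines_matching_of_typeGOrd_of_even (hp5 : 5 ≤ p)
    (hG : TypeGOrd W p) (hadd : Addv W p) (h2e : 2 ∣ semistabilityIndex W p)
    (he2 : semistabilityIndex W p ≠ 2) (hodd : ¬ 2 ∣ (p - 1) / semistabilityIndex W p)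
    (hG₁ : TypeGOrd W₁ p) (hadd₁ : Addv W₁ p) (h2e₁ : 2 ∣ semistabilityIndex W₁ p)
    (he2₁ : semistabilityIndex W₁ p ≠ 2) (hodd₁ : ¬ 2 ∣ (p - 1) / semistabilityIndex W₁ p)
    (hpv : ((p : ℕ) : 𝓞 ℚ) ∈ v.asIdeal) :
    ∃ (L : LocalDatum ℚ ↥(W.geomPrimaryTorsion p) v) (L₁ : LocalDatum ℚ ↥(W₁.geomPrimaryTorsion p) v),
      IsRamifiedOrdinaryLine W p L ∧ IsRamifiedOrdinaryLine W₁ p L₁ ∧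
      ∀ e : ↥(geomTorsion W (p : ℤ)) ≃+ ↥(geomTorsion W₁ (p : ℤ)),
        (∀ (σ : absoluteGaloisGroup ℚ) (P : ↥(geomTorsion W (p : ℤ))), e (σ • P) = σ • e P) →
        ∀ P : ↥(geomTorsion W (p : ℤ)),
          AddSubgroup.inclusion (geomTorsion_le_geomPrimaryTorsion W p) P ∈ L.plus ↔
            AddSubgroup.inclusion (geomTorsion_le_geomPrimaryTorsion W₁ p) (e P) ∈ L₁.plus := by
  have hp2 : p ≠ 2 := by omega
  obtain ⟨L, hL, hℓ⟩ :=
    exists_isRamifiedOrdinaryLine_and_lineHalfPow_of_typeGOrd W p hp5 hG hadd h2e he2 hodd hpv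
  obtain ⟨L₁, hL₁, hℓ₁⟩ :=
    exists_isRamifiedOrdinaryLine_and_lineHalfPow_of_typeGOrd W₁ p hp5 hG₁ hadd₁ h2e₁ he2₁ hodd₁ hpv
  exact hL.exists_lines_matching_of_lineHalfPow hp2 hL₁ hpv hℓ hℓ₁

/-- **Matching for ANY pair of ramified ordinary lines** of two such curves, under an
inertia-equivariant `E[p] ≃+ E₁[p]` (S4 `inclusion_mem_iff_of_lineHalfPow` fed by the END on both
members). [cite: GreenbergVatsal2000, §2 p. 26 and Remark (2.9)] -/
theorem inclusion_mem_iff_of_typeGOrd_of_even (hp5 : 5 ≤ p)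
    (hG : TypeGOrd W p) (hadd : Addv W p) (h2e : 2 ∣ semistabilityIndex W p)
    (he2 : semistabilityIndex W p ≠ 2) (hodd : ¬ 2 ∣ (p - 1) / semistabilityIndex W p)
    (hG₁ : TypeGOrd W₁ p) (hadd₁ : Addv W₁ p) (h2e₁ : 2 ∣ semistabilityIndex W₁ p)
    (he2₁ : semistabilityIndex W₁ p ≠ 2) (hodd₁ : ¬ 2 ∣ (p - 1) / semistabilityIndex W₁ p)
    (hpv : ((p : ℕ) : 𝓞 ℚ) ∈ v.asIdeal)
    {L : LocalDatum ℚ ↥(W.geomPrimaryTorsion p) v} {L₁ : LocalDatum ℚ ↥(W₁.geomPrimaryTorsion p) v}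
    (hL : IsRamifiedOrdinaryLine W p L) (hL₁ : IsRamifiedOrdinaryLine W₁ p L₁)
    (e : ↥(geomTorsion W (p : ℤ)) ≃+ ↥(geomTorsion W₁ (p : ℤ)))
    (he : ∀ σ ∈ absInertia (v.adicCompletion ℚ), ∀ P : ↥(geomTorsion W (p : ℤ)),
      e (absGaloisRestrict ℚ (v.adicCompletion ℚ) σ • P) =
        absGaloisRestrict ℚ (v.adicCompletion ℚ) σ • e P)
    (P : ↥(geomTorsion W (p : ℤ))) :
    AddSubgroup.inclusion (geomTorsion_le_geomPrimaryTorsion W p) P ∈ L.plus ↔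
      AddSubgroup.inclusion (geomTorsion_le_geomPrimaryTorsion W₁ p) (e P) ∈ L₁.plus := by
  have hp2 : p ≠ 2 := by omega
  exact hL.inclusion_mem_iff_of_lineHalfPow hp2 hL₁ hpv
    (hL.lineHalfPow_of_typeGOrd_of_even hp5 hG hadd h2e he2 hodd hpv)
    (hL₁.lineHalfPow_of_typeGOrd_of_even hp5 hG₁ hadd₁ h2e₁ he2₁ hodd₁ hpv) e he P

/-- **X4♯(G-ord) × X4♯(G-ord) pair form** (cells `(5; 4,4)`, `(7; 6,6)` of the N10 `CellGordHigher`
congruence links): matching lines under every `Γ_ℚ`-equivariant `E[p] ≃+ E₁[p]`. X4♯(G-ord) stays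
CONSTRUCTION-SHAPED; nothing booked. [cite: GreenbergVatsal2000, §2 p. 26 and Remark (2.9)] -/
theorem ClassX4Gord.exists_lines_matching_of_even_of_ne_two (hX : ClassX4Gord W p)
    (hX₁ : ClassX4Gord W₁ p) (hp5 : 5 ≤ p)
    (h2e : 2 ∣ semistabilityIndex W p) (he2 : semistabilityIndex W p ≠ 2)
    (hodd : ¬ 2 ∣ (p - 1) / semistabilityIndex W p)
    (h2e₁ : 2 ∣ semistabilityIndex W₁ p) (he2₁ : semistabilityIndex W₁ p ≠ 2)
    (hodd₁ : ¬ 2 ∣ (p - 1) / semistabilityIndex W₁ p) (hpv : ((p : ℕ) : 𝓞 ℚ) ∈ v.asIdeal) :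
    ∃ (L : LocalDatum ℚ ↥(W.geomPrimaryTorsion p) v) (L₁ : LocalDatum ℚ ↥(W₁.geomPrimaryTorsion p) v),
      IsRamifiedOrdinaryLine W p L ∧ IsRamifiedOrdinaryLine W₁ p L₁ ∧
      ∀ e : ↥(geomTorsion W (p : ℤ)) ≃+ ↥(geomTorsion W₁ (p : ℤ)),
        (∀ (σ : absoluteGaloisGroup ℚ) (P : ↥(geomTorsion W (p : ℤ))), e (σ • P) = σ • e P) →
        ∀ P : ↥(geomTorsion W (p : ℤ)),
          AddSubgroup.inclusion (geomTorsion_le_geomPrimaryTorsion W p) P ∈ L.plus ↔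
            AddSubgroup.inclusion (geomTorsion_le_geomPrimaryTorsion W₁ p) (e P) ∈ L₁.plus :=
  exists_lines_matching_of_typeGOrd_of_even hp5 hX.typeGOrd hX.addv.2 h2e he2 hodd hX₁.typeGOrd
    hX₁.addv.2 h2e₁ he2₁ hodd₁ hpv

/-- **X3♯(G-ord) × X3♯(G-ord) pair form**: matching lines under every `Γ_ℚ`-equivariant
`E[p] ≃+ E₁[p]`. X3♯(G-ord) stays CONSTRUCTION-SHAPED; nothing booked.
[cite: GreenbergVatsal2000, §2 p. 26 and Remark (2.9)] -/
theorem ClassX3Gord.exists_lines_matching_of_even_of_ne_two (hX : ClassX3Gord W p)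
    (hX₁ : ClassX3Gord W₁ p) (hp5 : 5 ≤ p)
    (h2e : 2 ∣ semistabilityIndex W p) (he2 : semistabilityIndex W p ≠ 2)
    (hodd : ¬ 2 ∣ (p - 1) / semistabilityIndex W p)
    (h2e₁ : 2 ∣ semistabilityIndex W₁ p) (he2₁ : semistabilityIndex W₁ p ≠ 2)
    (hodd₁ : ¬ 2 ∣ (p - 1) / semistabilityIndex W₁ p) (hpv : ((p : ℕ) : 𝓞 ℚ) ∈ v.asIdeal) :
    ∃ (L : LocalDatum ℚ ↥(W.geomPrimaryTorsion p) v) (L₁ : LocalDatum ℚ ↥(W₁.geomPrimaryTorsion p) v),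
      IsRamifiedOrdinaryLine W p L ∧ IsRamifiedOrdinaryLine W₁ p L₁ ∧
      ∀ e : ↥(geomTorsion W (p : ℤ)) ≃+ ↥(geomTorsion W₁ (p : ℤ)),
        (∀ (σ : absoluteGaloisGroup ℚ) (P : ↥(geomTorsion W (p : ℤ))), e (σ • P) = σ • e P) →
        ∀ P : ↥(geomTorsion W (p : ℤ)),
          AddSubgroup.inclusion (geomTorsion_le_geomPrimaryTorsion W p) P ∈ L.plus ↔
            AddSubgroup.inclusion (geomTorsion_le_geomPrimaryTorsion W₁ p) (e P) ∈ L₁.plus :=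
  exists_lines_matching_of_typeGOrd_of_even hp5 hX.typeGOrd hX.addv h2e he2 hodd hX₁.typeGOrd
    hX₁.addv h2e₁ he2₁ hodd₁ hpv

end Summit.BirchSwinnertonDyer.Rank1Residual.Additive

end
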